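import Summits.HubbardSuperconductivity.HubbardLadder.HeisenbergPlusAntipodalRowAlgebra

/-!
# Plus-antipodal laminar Lieb–Mattis row — part B: positivity (pseudo F29; STAGED, not filed; chain A → B → C)

HONEST FRAMING: ladder R1–R4 with certified numbers; no claim on H/H₀.
`posSemidef_plusRow` : for pairwise-distinct sites `c, n, s, e, w` of a finite spin-½ system,
`3𝐋²_{n,s} + 3𝐋²_{e,w} - 𝐋²_{n,s,e,w} + 4 Σ_{arms} 𝐒_c·𝐒_y ⪰ 0` (sector split along the pair
singlet/triplet projections; odd-set Casimir bound on the singlet sectors, Casimir bound + Anderson's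
`k = 4, n = 2` star row on the triplet–triplet sector), and `posSemidef_ceilingRow` :
`5 + 2(𝐒_n·𝐒_s + 𝐒_e·𝐒_w) + 4 Σ_{arms} 𝐒_c·𝐒_y ⪰ 0` (= (plusRow + star row)/3; in reduced torus
correlations `c(0,2) + 4c(0,1) + 5/12 ≥ 0`, the energy-ceiling conversion row).
Intended tree path: `Summits/HubbardSuperconductivity/HubbardLadder/HeisenbergPlusAntipodalRow.lean`.
-/


noncomputable section

open Matrix Complex Finset
open scoped ComplexOrder Matrix.Norms.L2Operator MatrixOrder

namespace Summit.HubbardSuperconductivity.HubbardLadder.PlusAntipodal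

open Literature.MathematicalPhysics.QuantumLattice SpinOperators

variable {Λ : Type*} [Fintype Λ] [DecidableEq Λ]

section Leaves

variable [Nonempty Λ] {c n s e w : Λ}

/-- Singlet leaf: if the pair `{n,s}` is in its singlet sector on `φ` (all three components of
`𝐒_n + 𝐒_s` annihilate `φ`), the row's quadratic form at `φ` equals `2⟨φ, (𝐋²_{c,e,w} - ¾) φ⟩ ≥ 0`. -/
theorem qf_plusRow_nonneg_of_singlet (hcn : c ≠ n) (hcs : c ≠ s) (hce : c ≠ e) (hcw : c ≠ w)
    (hns : n ≠ s) (hne : n ≠ e) (hnw : n ≠ w) (hse : s ≠ e) (hsw : s ≠ w) (hew : e ≠ w)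
    (φ : TensorIndex Λ 2 → ℂ)
    (h0 : ∀ α, (∑ y ∈ ({n, s} : Finset Λ), siteSpin 1 y α : Op Λ 2) *ᵥ φ = 0) :
    0 ≤ star φ ⬝ᵥ (plusRow c n s e w *ᵥ φ) := by
  have hcE : c ∉ ({e, w} : Finset Λ) := by simp [hce, hcw]
  have hcA : c ∉ ({n, s, e, w} : Finset Λ) := by simp [hcn, hcs, hce, hcw]
  -- the arm spin acts through the `ew` pair
  have hA : ∀ α, (∑ y ∈ ({n, s, e, w} : Finset Λ), siteSpin 1 y α : Op Λ 2) *ᵥ φ =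
      (∑ y ∈ ({e, w} : Finset Λ), siteSpin 1 y α : Op Λ 2) *ᵥ φ := by
    intro α; rw [setSpin_arms hns hne hnw hse hsw, Matrix.add_mulVec, h0, zero_add]
  have hV : ((∑ α : Fin 3, (∑ y ∈ ({n, s} : Finset Λ), siteSpin 1 y α) * (∑ y ∈ ({n, s} : Finset Λ), siteSpin 1 y α) : Op _ 2) : Op Λ 2) *ᵥ φ = 0 := by
    rw [Matrix.sum_mulVec]
    exact Finset.sum_eq_zero fun α _ => by rw [← Matrix.mulVec_mulVec, h0, Matrix.mulVec_zero]
  have hT : star φ ⬝ᵥ (((∑ α : Fin 3, (∑ y ∈ ({n, s, e, w} : Finset Λ), siteSpin 1 y α) * (∑ y ∈ ({n, s, e, w} : Finset Λ), siteSpin 1 y α) : Op _ 2) : Op Λ 2) *ᵥ φ) =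
      star φ ⬝ᵥ (((∑ α : Fin 3, (∑ y ∈ ({e, w} : Finset Λ), siteSpin 1 y α) * (∑ y ∈ ({e, w} : Finset Λ), siteSpin 1 y α) : Op _ 2) : Op Λ 2) *ᵥ φ) := by
    rw [Matrix.sum_mulVec, Matrix.sum_mulVec, dotProduct_sum, dotProduct_sum]
    exact Finset.sum_congr rfl fun α _ =>
      qf_sq_eq (setSpin_isHermitian' _ α) (setSpin_isHermitian' _ α) (hA α)
  have hG : (∑ y ∈ ({n, s, e, w} : Finset Λ), spinDot 1 c y : Op Λ 2) *ᵥ φ =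
      (∑ y ∈ ({e, w} : Finset Λ), spinDot 1 c y : Op Λ 2) *ᵥ φ := by
    rw [heisStar_eq_sum 1 hcA, heisStar_eq_sum 1 hcE, Matrix.sum_mulVec, Matrix.sum_mulVec]
    exact Finset.sum_congr rfl fun α _ => by
      rw [← Matrix.mulVec_mulVec, ← Matrix.mulVec_mulVec, hA α]
  -- the odd-set bound on `{c,e,w}`
  have hcard : ({c, e, w} : Finset Λ).card % 2 = 1 := by
    rw [Finset.card_insert_of_notMem hcE, Finset.card_pair hew]
  have hX := (posSemidef_setSpinSq_sub_of_odd ({c, e, w} : Finset Λ) hcard).dotProduct_mulVec_nonneg φ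
  have hins := setSpinSq_insert hcE
  -- `{c,e,w} = insert c {e,w}` syntactically
  rw [hins, add_sub_cancel_right, Matrix.add_mulVec, Matrix.smul_mulVec, dotProduct_add,
    dotProduct_smul, smul_eq_mul] at hX
  -- assemble
  have h2 : (0 : ℂ) ≤ 2 := by exact_mod_cast (show (0 : ℝ) ≤ 2 by norm_num)
  have key := mul_nonneg h2 hX
  unfold plusRow
  simp only [Matrix.add_mulVec, Matrix.sub_mulVec, Matrix.smul_mulVec, hV, hG, smul_zero, zero_add,
    dotProduct_add, dotProduct_sub, dotProduct_smul, smul_eq_mul, hT]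
  convert key using 1
  ring

/-- Triplet leaf: if both pairs are in their triplet sector on `φ` (`𝐋²_{ns} φ = 2φ = 𝐋²_{ew} φ`),
the row's quadratic form at `φ` is `(3/2)⟨6 - 𝐋²_{arms}⟩ + ½⟨𝐋²_{arms} + 8G + 6⟩ ≥ 0`. -/
theorem qf_plusRow_nonneg_of_triplet (hcn : c ≠ n) (hcs : c ≠ s) (hce : c ≠ e) (hcw : c ≠ w)
    (hns : n ≠ s) (hne : n ≠ e) (hnw : n ≠ w) (hse : s ≠ e) (hsw : s ≠ w) (hew : e ≠ w)
    (φ : TensorIndex Λ 2 → ℂ)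
    (hV : ((∑ α : Fin 3, (∑ y ∈ ({n, s} : Finset Λ), siteSpin 1 y α) * (∑ y ∈ ({n, s} : Finset Λ), siteSpin 1 y α) : Op _ 2) : Op Λ 2) *ᵥ φ = (2 : ℂ) • φ)
    (hW : ((∑ α : Fin 3, (∑ y ∈ ({e, w} : Finset Λ), siteSpin 1 y α) * (∑ y ∈ ({e, w} : Finset Λ), siteSpin 1 y α) : Op _ 2) : Op Λ 2) *ᵥ φ = (2 : ℂ) • φ) :
    0 ≤ star φ ⬝ᵥ (plusRow c n s e w *ᵥ φ) := by
  have hcA : c ∉ ({n, s, e, w} : Finset Λ) := by simp [hcn, hcs, hce, hcw]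
  have hcard : ({n, s, e, w} : Finset Λ).card = 4 := by
    have h1 : n ∉ ({s, e, w} : Finset Λ) := by simp [hns, hne, hnw]
    have h2 : s ∉ ({e, w} : Finset Λ) := by simp [hse, hsw]
    rw [Finset.card_insert_of_notMem h1, Finset.card_insert_of_notMem h2, Finset.card_pair hew]
  have hk : ({n, s, e, w} : Finset Λ).card % 2 = 0 := by rw [hcard]
  -- Casimir bound `𝐋²_{arms} ≤ 6`
  have h1 := (posSemidef_casimirBound_sub ({n, s, e, w} : Finset Λ)).dotProduct_mulVec_nonneg φ
  rw [hcard, Matrix.sub_mulVec, dotProduct_sub, qf_smul] at h1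
  push_cast at h1
  -- star row `𝐋²_{arms} + 8G + 6 ⪰ 0` (`k = 4`, `n = 2`)
  have h2 := (posSemidef_heisStar_row_even hcA hk 2).dotProduct_mulVec_nonneg φ
  rw [Matrix.add_mulVec, Matrix.add_mulVec, Matrix.smul_mulVec, dotProduct_add, dotProduct_add,
    dotProduct_smul, smul_eq_mul, qf_smul] at h2
  push_cast at h2
  -- assemble
  have h32 : (0 : ℂ) ≤ 3 / 2 := by
    have : ((3 / 2 : ℝ) : ℂ) = 3 / 2 := by push_cast; ring
    rw [← this]; exact Complex.zero_le_real.2 (by norm_num)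
  have h12 : (0 : ℂ) ≤ 1 / 2 := by
    have : ((1 / 2 : ℝ) : ℂ) = 1 / 2 := by push_cast; ring
    rw [← this]; exact Complex.zero_le_real.2 (by norm_num)
  have key := add_nonneg (mul_nonneg h32 h1) (mul_nonneg h12 h2)
  unfold plusRow
  simp only [Matrix.add_mulVec, Matrix.sub_mulVec, Matrix.smul_mulVec, hV, hW, dotProduct_add,
    dotProduct_sub, dotProduct_smul, smul_eq_mul]
  convert key using 1
  ring

/-- **The plus-antipodal laminar row.**  For pairwise distinct sites `c, n, s, e, w`:
`3𝐋²_{n,s} + 3𝐋²_{e,w} - 𝐋²_{n,s,e,w} + 4 Σ_{y∈{n,s,e,w}} 𝐒_c·𝐒_y ⪰ 0`. -/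
theorem posSemidef_plusRow (hcn : c ≠ n) (hcs : c ≠ s) (hce : c ≠ e) (hcw : c ≠ w)
    (hns : n ≠ s) (hne : n ≠ e) (hnw : n ≠ w) (hse : s ≠ e) (hsw : s ≠ w) (hew : e ≠ w) :
    (plusRow c n s e w).PosSemidef := by
  -- Hermitian
  have h3 : IsSelfAdjoint (3 : ℂ) := by rw [isSelfAdjoint_iff, Complex.star_def, map_ofNat]
  have h4 : IsSelfAdjoint (4 : ℂ) := by rw [isSelfAdjoint_iff, Complex.star_def, map_ofNat]
  have hherm : (plusRow c n s e w).IsHermitian := by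
    unfold plusRow
    exact ((((setSpinSq_isHermitian _).smul h3).add ((setSpinSq_isHermitian _).smul h3)).sub
      (setSpinSq_isHermitian _)).add ((heisStar_isHermitian 1 c _).smul h4)
  -- the two pair Casimirs `V = 𝐋²_{ns}`, `W = 𝐋²_{ew}` and the projections `P = V/2`, `R = W/2`
  have hVV := pair_setSpinSq_mul_self (Λ := Λ) hns
  have hWW := pair_setSpinSq_mul_self (Λ := Λ) hew
  have hVO : Commute ((∑ α : Fin 3, (∑ y ∈ ({n, s} : Finset Λ), siteSpin 1 y α) * (∑ y ∈ ({n, s} : Finset Λ), siteSpin 1 y α) : Op _ 2) : Op Λ 2) (plusRow c n s e w) := by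
    rw [pair_setSpinSq hns]
    exact ((Commute.one_left _).smul_left _).add_left
      ((commute_pair_plusRow hcn hcs hce hcw hns hne hnw hse hsw).smul_left _)
  have hWO : Commute ((∑ α : Fin 3, (∑ y ∈ ({e, w} : Finset Λ), siteSpin 1 y α) * (∑ y ∈ ({e, w} : Finset Λ), siteSpin 1 y α) : Op _ 2) : Op Λ 2) (plusRow c n s e w) := by
    rw [← plusRow_swap, pair_setSpinSq hew]
    exact ((Commute.one_left _).smul_left _).add_left
      ((commute_pair_plusRow hce hcw hcn hcs hew hne.symm hse.symm hnw.symm hsw.symm).smul_left _)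
  have hVW : Commute ((∑ α : Fin 3, (∑ y ∈ ({n, s} : Finset Λ), siteSpin 1 y α) * (∑ y ∈ ({n, s} : Finset Λ), siteSpin 1 y α) : Op _ 2) : Op Λ 2) ((∑ α : Fin 3, (∑ y ∈ ({e, w} : Finset Λ), siteSpin 1 y α) * (∑ y ∈ ({e, w} : Finset Λ), siteSpin 1 y α) : Op _ 2) : Op Λ 2) := by
    rw [pair_setSpinSq hns, pair_setSpinSq hew]
    exact (((Commute.one_left _).smul_left _).add_left ((((Commute.one_right _).smul_right _).add_right
      ((commute_spinDot_spinDot hns hew hne hnw hse hsw).smul_right _)).smul_left _))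
  set V : Op Λ 2 := (∑ α : Fin 3, (∑ y ∈ ({n, s} : Finset Λ), siteSpin 1 y α) * (∑ y ∈ ({n, s} : Finset Λ), siteSpin 1 y α) : Op _ 2) with hVdef
  set W : Op Λ 2 := (∑ α : Fin 3, (∑ y ∈ ({e, w} : Finset Λ), siteSpin 1 y α) * (∑ y ∈ ({e, w} : Finset Λ), siteSpin 1 y α) : Op _ 2) with hWdef
  set O : Op Λ 2 := plusRow c n s e w with hOdef
  set P : Op Λ 2 := (1 / 2 : ℂ) • V with hPdef
  set R : Op Λ 2 := (1 / 2 : ℂ) • W with hRdef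
  have h12 : IsSelfAdjoint (1 / 2 : ℂ) := by
    rw [isSelfAdjoint_iff, Complex.star_def, map_div₀, map_one, map_ofNat]
  have hP : Pᴴ = P := ((setSpinSq_isHermitian _).smul h12).eq
  have hR : Rᴴ = R := ((setSpinSq_isHermitian _).smul h12).eq
  have hPP : P * P = P := by
    rw [hPdef, Matrix.smul_mul, Matrix.mul_smul, hVV, smul_smul, smul_smul]; norm_num
  have hRR : R * R = R := by
    rw [hRdef, Matrix.smul_mul, Matrix.mul_smul, hWW, smul_smul, smul_smul]; norm_num
  have hPO : P * O = O * P := by rw [hPdef, Matrix.smul_mul, Matrix.mul_smul, hVO.eq]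
  have hRO : R * O = O * R := by rw [hRdef, Matrix.smul_mul, Matrix.mul_smul, hWO.eq]
  have hV0 : V * (1 - P) = 0 := by
    rw [hPdef, Matrix.mul_sub, Matrix.mul_one, Matrix.mul_smul, hVV, smul_smul]; norm_num
  have hW0 : W * (1 - R) = 0 := by
    rw [hRdef, Matrix.mul_sub, Matrix.mul_one, Matrix.mul_smul, hWW, smul_smul]; norm_num
  have hVP : V * P = (2 : ℂ) • P := by
    rw [hPdef, Matrix.mul_smul, hVV, smul_smul, smul_smul]; norm_num
  have hWR : W * R = (2 : ℂ) • R := by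
    rw [hRdef, Matrix.mul_smul, hWW, smul_smul, smul_smul]; norm_num
  have hVR : V * R = R * V := by rw [hRdef, Matrix.mul_smul, Matrix.smul_mul, hVW.eq]
  -- vectors
  refine Matrix.PosSemidef.of_dotProduct_mulVec_nonneg hherm fun ψ => ?_
  rw [qf_split O P hP hPP hPO ψ, qf_split O R hR hRR hRO (P *ᵥ ψ)]
  refine add_nonneg (add_nonneg ?_ ?_) ?_
  · -- triplet–triplet part `R P ψ`
    apply qf_plusRow_nonneg_of_triplet hcn hcs hce hcw hns hne hnw hse hsw hew
    · have h' : V * (R * P) = (2 : ℂ) • (R * P) := by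
        rw [← Matrix.mul_assoc, hVR, Matrix.mul_assoc, hVP, Matrix.mul_smul]
      rw [Matrix.mulVec_mulVec, Matrix.mulVec_mulVec, Matrix.mul_assoc, h', Matrix.smul_mulVec,
        ← Matrix.mulVec_mulVec]
    · rw [Matrix.mulVec_mulVec, hWR, Matrix.smul_mulVec]
  · -- `P ψ` in the `ew`-singlet sector
    have hz : W *ᵥ ((1 - R) *ᵥ (P *ᵥ ψ)) = 0 := by
      rw [Matrix.mulVec_mulVec, hW0, Matrix.zero_mulVec]
    have h := qf_plusRow_nonneg_of_singlet hce hcw hcn hcs hew hne.symm hse.symm hnw.symm hsw.symm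
      hns _ (setSpin_mulVec_eq_zero hz)
    rwa [plusRow_swap] at h
  · -- `ψ` in the `ns`-singlet sector
    have hz : V *ᵥ ((1 - P) *ᵥ ψ) = 0 := by
      rw [Matrix.mulVec_mulVec, hV0, Matrix.zero_mulVec]
    exact qf_plusRow_nonneg_of_singlet hcn hcs hce hcw hns hne hnw hse hsw hew _
      (setSpin_mulVec_eq_zero hz)

/-- **The energy-to-`c(0,2)` conversion row.**  For pairwise distinct sites `c, n, s, e, w`:
`5 + 2(𝐒_n·𝐒_s + 𝐒_e·𝐒_w) + 4 Σ_{y∈{n,s,e,w}} 𝐒_c·𝐒_y ⪰ 0` — one third of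
`plusRow + (𝐋²_{arms} + 8 G + 6)` (the plus-antipodal row plus Anderson's `k = 4`, `n = 2` star row).
In a translation/rotation-invariant state with arms at `(0,±1), (±1,0)` and `3c(d) = ⟨𝐒_0·𝐒_d⟩` its
expectation is `5 + 12c(0,2) + 48c(0,1)`, i.e. the LP row `c(0,2) + 4c(0,1) + 5/12 ≥ 0`: any
ground-state energy CEILING `c(0,1) ≤ x` yields the FLOOR `c(0,2) ≥ -4x - 5/12` with no infrared input
(positive as soon as `x < -5/48`, i.e. energy per site below `-5/8`). -/
theorem posSemidef_ceilingRow (hcn : c ≠ n) (hcs : c ≠ s) (hce : c ≠ e) (hcw : c ≠ w)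
    (hns : n ≠ s) (hne : n ≠ e) (hnw : n ≠ w) (hse : s ≠ e) (hsw : s ≠ w) (hew : e ≠ w) :
    ((5 : ℂ) • (1 : Op Λ 2) + (2 : ℂ) • (spinDot 1 n s + spinDot 1 e w : Op Λ 2)
      + (4 : ℂ) • (spinDot 1 c n + spinDot 1 c s + spinDot 1 c e + spinDot 1 c w : Op Λ 2)).PosSemidef := by
  have hcA : c ∉ ({n, s, e, w} : Finset Λ) := by simp [hcn, hcs, hce, hcw]
  have h1 : n ∉ ({s, e, w} : Finset Λ) := by simp [hns, hne, hnw]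
  have h2 : s ∉ ({e, w} : Finset Λ) := by simp [hse, hsw]
  have hcard : ({n, s, e, w} : Finset Λ).card = 4 := by
    rw [Finset.card_insert_of_notMem h1, Finset.card_insert_of_notMem h2, Finset.card_pair hew]
  have hk : ({n, s, e, w} : Finset Λ).card % 2 = 0 := by rw [hcard]
  have hT : ((∑ α : Fin 3, (∑ y ∈ ({n, s, e, w} : Finset Λ), siteSpin 1 y α) * (∑ y ∈ ({n, s, e, w} : Finset Λ), siteSpin 1 y α) : Op _ 2) : Op Λ 2) = (3 : ℂ) • (1 : Op Λ 2) + (2 : ℂ) •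
      (spinDot 1 n s + spinDot 1 n e + spinDot 1 n w + spinDot 1 s e + spinDot 1 s w + spinDot 1 e w
        : Op Λ 2) := by
    rw [setSpinSq_insert h1, setSpinSq_insert h2, pair_setSpinSq hew, Finset.sum_insert h2,
      Finset.sum_pair hew, Finset.sum_pair hew]
    module
  have hG : (∑ y ∈ ({n, s, e, w} : Finset Λ), spinDot 1 c y : Op Λ 2) =
      spinDot 1 c n + spinDot 1 c s + spinDot 1 c e + spinDot 1 c w := by
    rw [Finset.sum_insert h1, Finset.sum_insert h2, Finset.sum_pair hew]; abel
  -- Hermitian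
  have k5 : IsSelfAdjoint (5 : ℂ) := by rw [isSelfAdjoint_iff, Complex.star_def, map_ofNat]
  have k2 : IsSelfAdjoint (2 : ℂ) := by rw [isSelfAdjoint_iff, Complex.star_def, map_ofNat]
  have k4 : IsSelfAdjoint (4 : ℂ) := by rw [isSelfAdjoint_iff, Complex.star_def, map_ofNat]
  have hherm : ((5 : ℂ) • (1 : Op Λ 2) + (2 : ℂ) • (spinDot 1 n s + spinDot 1 e w : Op Λ 2)
      + (4 : ℂ) • (spinDot 1 c n + spinDot 1 c s + spinDot 1 c e + spinDot 1 c w : Op Λ 2)).IsHermitian :=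
    ((Matrix.isHermitian_one.smul k5).add
      (((spinDot_isHermitian 1 n s).add (spinDot_isHermitian 1 e w)).smul k2)).add
      (((((spinDot_isHermitian 1 c n).add (spinDot_isHermitian 1 c s)).add
        (spinDot_isHermitian 1 c e)).add (spinDot_isHermitian 1 c w)).smul k4)
  refine Matrix.PosSemidef.of_dotProduct_mulVec_nonneg hherm fun ψ => ?_
  -- the plus-antipodal row and the `k = 4`, `n = 2` star row, as quadratic forms
  have q1 := (posSemidef_plusRow hcn hcs hce hcw hns hne hnw hse hsw hew).dotProduct_mulVec_nonneg ψ
  rw [plusRow_eq hns hne hnw hse hsw hew] at q1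
  have q2 := (posSemidef_heisStar_row_even hcA hk 2).dotProduct_mulVec_nonneg ψ
  rw [hT, hG] at q2
  simp only [Matrix.add_mulVec, Matrix.sub_mulVec, Matrix.smul_mulVec, Matrix.one_mulVec,
    dotProduct_add, dotProduct_sub, dotProduct_smul, smul_eq_mul] at q1 q2 ⊢
  push_cast at q2
  have h13 : (0 : ℂ) ≤ 1 / 3 := by
    have : ((1 / 3 : ℝ) : ℂ) = 1 / 3 := by push_cast; ring
    rw [← this]; exact Complex.zero_le_real.2 (by norm_num)
  have key := mul_nonneg h13 (add_nonneg q1 q2)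
  convert key using 1
  ring

end Leaves

end Summit.HubbardSuperconductivity.HubbardLadder.PlusAntipodal
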